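import Summits.Ventures.CertifiedManyBodySolver.Downfold.ThreeToOneBand
import HarnessLib

/-!
# Three-band → one-band: the PER-COORDINATE assumption clauses of technique B, their soundness,
# and the band-misfit rule `r = ρ/4` as a kernel constructor

Venture CertifiedManyBodySolver, cell `pub/hubbard-downfold` (stage S1 = DOWNFOLDING FRONT END;
HUMAN RULING D-0096: «the three-band → one-band reduction error is carried as box inflation, never
hidden»), seat hubbard-downfold-mod-4 (writer); first half of amendment A1 + note N2 of the
reviewer's REVIEW v1 (hubbard-downfold-unc-3, 2026-08-26). APPEND-ONLY companion of
`Downfold.ThreeToOneBand` (v0): nothing there is changed. Everything here is PROVED.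
WHAT THIS IS NOT: a certified statement about any material; not a claim that a cuprate IS a
one-band Hubbard model — the clauses below ARE that assumption, printed with every box per
coordinate and never discharged inside Lean; no literature number lives here.

Why (reviewer A1, load-bearing for applicability): v0's `ReductionTokenB` asserts the `t′`, `t″`
closeness clauses UNCONDITIONALLY while `imageB` uses them only when `cfg.ratios = true`; for the
boxes of record (cell ruling A6-iv: three-band-internal `t′` is CONTEXT ⇒ `ratios = false`) the
printed v0 token claims something false for La₂CuO₄ (B's `t′ ≈ −0.03 eV` vs the one-band fit's
`≈ −0.1 eV`), so word transport from it is vacuous there. The repair is to claim EXACTLY one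
clause per EMITTED coordinate; this file supplies the clauses and their per-coordinate soundness
(for v0's `imageB` already), `Downfold.ThreeToOneBandV1` assembles the v1 token and box.

* §1 `eq_of_inputsB_eq_some`, `ratios_of_imageB_tpOverT/tppOverT` (what an emitted entry
  reveals about the configuration).
* §2 `EmeryPoint E Δ t_pd t_pp t_pp′` (a point of the three-band box), `NearTB / NearTpB / NearTppB`
  («within the declared misfit `rT / rTp / rTpp` of technique B's `t / t′ / t″` at SOME box
  point»), the PER-COORDINATE CLAUSE `CoordTokenB cfg E i x` (`t_eV`: `NearTB x`; `tp/t`: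
  `x = t′/t` with `NearTB t`, `NearTpB t′`; `tpp/t` likewise; `U/t`: `x = U/t` with `U` in the
  supplied one-band `U` determination and `NearTB t`; `n`: the filling entry encloses `2 − x`;
  `True` elsewhere), PER-COORDINATE SOUNDNESS `mem_of_coordTokenB`, and
  `imageB_mem_of_coordTokens` (v0's box encloses `p` once the clause holds wherever v0 emits).
* §3 (reviewer N2: the rule `r = ρ/4` as a theorem) `BandMisfitB`: the material's one-band
  energies at Γ, X, M, S lie within `ρ` of technique B's antibonding band `(0, abX, abM, abS)` at a
  box point up to a common shift; then the four-point extracted `(t, t′, t″)`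
  (`EmeryBlochBand.extractT/Tp/Tpp`) are within `ρ/4` of `(tB4, tpB4, tppB4)` and
  `near_of_bandMisfit` / `coordTokenB_of_bandMisfit` deliver the clauses once `ρ/4 ≤ rT, rTp, rTpp`.
-/

namespace Summit.Ventures.CertifiedManyBodySolver.Downfold

open NonemptyInterval Literature.Analysis.ValidatedNumerics
open Summit.Ventures.CertifiedManyBodySolver.Downfold.Emery

/-! ## §1 What an emitted entry reveals about the configuration -/

/-- The four inputs read off `inputsB`. [folklore] -/
theorem eq_of_inputsB_eq_some {E : EmeryBox} {eD eA eB eC : Entry}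
    (h : inputsB E = some (eD, eA, eB, eC)) :
    E .DeltaPd = some eD ∧ E .tpd = some eA ∧ E .tpp = some eB ∧ E .tppP = some eC := by
  unfold inputsB at h
  cases h1 : E .DeltaPd with
  | none => simp [h1] at h
  | some x =>
    cases h2 : E .tpd with
    | none => simp [h1, h2] at h
    | some y =>
      cases h3 : E .tpp with
      | none => simp [h1, h2, h3] at h
      | some z =>
        cases h4 : E .tppP with
        | none => simp [h1, h2, h3, h4] at h
        | some w =>
          simp only [h1, h2, h3, h4, Option.some.injEq, Prod.mk.injEq] at h
          obtain ⟨rfl, rfl, rfl, rfl⟩ := h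
          exact ⟨rfl, rfl, rfl, rfl⟩

/-- If v0 emits `tp/t`, the `ratios` switch is on. [folklore] -/
theorem ratios_of_imageB_tpOverT {cfg : BConfig} {E : EmeryBox} {g : Entry}
    (hg : imageB cfg E .tpOverT = some g) : cfg.ratios = true := by
  simp only [imageB] at hg
  cases hin : inputsB E with
  | none => simp [hin] at hg
  | some triple =>
    obtain ⟨eD, eA, eB, eC⟩ := triple
    simp only [hin] at hg
    split_ifs at hg with hpos
    exact hpos.1

/-- If v0 emits `tpp/t`, the `ratios` switch is on. [folklore] -/
theorem ratios_of_imageB_tppOverT {cfg : BConfig} {E : EmeryBox} {g : Entry}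
    (hg : imageB cfg E .tppOverT = some g) : cfg.ratios = true := by
  simp only [imageB] at hg
  cases hin : inputsB E with
  | none => simp [hin] at hg
  | some triple =>
    obtain ⟨eD, eA, eB, eC⟩ := triple
    simp only [hin] at hg
    split_ifs at hg with hpos
    exact hpos.1

/-! ## §2 Box points, the `Near*` clauses, the per-coordinate clause and its soundness -/

/-- `(Δ, t_pd, t_pp, t_pp′)` is a POINT OF THE THREE-BAND BOX `E`: enclosed by every one of the
four one-body entries that is present. [folklore] -/
def EmeryPoint (E : EmeryBox) (Δ a b c : ℝ) : Prop :=
  (∀ e, E .DeltaPd = some e → e.Mem Δ) ∧ (∀ e, E .tpd = some e → e.Mem a) ∧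
  (∀ e, E .tpp = some e → e.Mem b) ∧ (∀ e, E .tppP = some e → e.Mem c)

/-- «`t` lies within the declared misfit `rT` of technique B's `t` at SOME point of the box.»
[folklore] -/
def NearTB (cfg : BConfig) (E : EmeryBox) (t : ℝ) : Prop :=
  ∃ Δ a b c : ℝ, EmeryPoint E Δ a b c ∧ |t - tB4 Δ a b c| ≤ (cfg.rT : ℚ)

/-- «`t′` lies within the declared misfit `rTp` of technique B's `t′` at SOME point of the box.»
[folklore] -/
def NearTpB (cfg : BConfig) (E : EmeryBox) (tp : ℝ) : Prop :=
  ∃ Δ a b c : ℝ, EmeryPoint E Δ a b c ∧ |tp - tpB4 Δ a b c| ≤ (cfg.rTp : ℚ)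

/-- «`t″` lies within the declared misfit `rTpp` of technique B's `t″` at SOME point of the box.»
[folklore] -/
def NearTppB (cfg : BConfig) (E : EmeryBox) (tpp : ℝ) : Prop :=
  ∃ Δ a b c : ℝ, EmeryPoint E Δ a b c ∧ |tpp - tppB4 Δ a b c| ≤ (cfg.rTpp : ℚ)

/-- **The per-coordinate assumption clause** of technique B for the value `x` of one-band
coordinate `i` (the physics, printed with the box next to that coordinate, never discharged in
Lean): `t_eV`: `NearTB x`; `tp/t`: `x = t′/t` for some `NearTB t`, `NearTpB t′`; `tpp/t`: likewise
with `NearTppB`; `U/t`: `x = U/t` with `U` enclosed by the supplied one-band `U` determination and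
`NearTB t`; `n`: the three-band filling entry encloses `2 − x`; no claim on other coordinates.
[folklore] -/
def CoordTokenB (cfg : BConfig) (E : EmeryBox) : OneBandCoord → ℝ → Prop
  | .tEV, x => NearTB cfg E x
  | .tpOverT, x => ∃ t tp : ℝ, NearTB cfg E t ∧ NearTpB cfg E tp ∧ x = tp / t
  | .tppOverT, x => ∃ t tpp : ℝ, NearTB cfg E t ∧ NearTppB cfg E tpp ∧ x = tpp / t
  | .UOverT, x => ∀ eU, cfg.uEV = some eU → ∃ t U : ℝ, NearTB cfg E t ∧ eU.Mem U ∧ x = U / t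
  | .filling, x => ∀ eN, E .nHoles = some eN → eN.Mem (2 - x)
  | _, _ => True

/-- A `NearTB` value lies in the inflated scale interval `tI ⊕ rT`. [folklore] -/
theorem mem_scaleB_of_nearTB {cfg : BConfig} {E : EmeryBox} {eD eA eB eC : Entry}
    (hD : E .DeltaPd = some eD) (hA : E .tpd = some eA) (hB : E .tpp = some eB)
    (hC : E .tppP = some eC) (hA0 : 0 < eA.encl.fst) {t : ℝ} (h : NearTB cfg E t) :
    t ∈ (scaleB cfg eD eA eB eC).ratCast ℝ := by
  obtain ⟨Δ, a, b, c, ⟨hΔ, ha, hb, hc⟩, ht⟩ := h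
  exact mem_inflate_of_abs_sub_le
    (tB4_mem_tI cfg.prec cfg.iters hA0.le (hΔ eD hD) (ha eA hA) (hb eB hB) (hc eC hC)) ht

/-- A `NearTpB` value lies in the inflated `t′` interval `tpIk ⊕ rTp`. [folklore] -/
theorem mem_tpIB_of_nearTpB {cfg : BConfig} {E : EmeryBox} {eD eA eB eC : Entry}
    (hD : E .DeltaPd = some eD) (hA : E .tpd = some eA) (hB : E .tpp = some eB)
    (hC : E .tppP = some eC) (hA0 : 0 < eA.encl.fst) {tp : ℝ} (h : NearTpB cfg E tp) :
    tp ∈ (tpIB cfg eD eA eB eC).ratCast ℝ := by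
  obtain ⟨Δ, a, b, c, ⟨hΔ, ha, hb, hc⟩, htp⟩ := h
  exact mem_inflate_of_abs_sub_le
    (tpB4_mem_tpIk cfg.prec cfg.iters cfg.nsplit hA0 (hΔ eD hD) (ha eA hA) (hb eB hB) (hc eC hC))
    htp

/-- A `NearTppB` value lies in the inflated `t″` interval `tppI ⊕ rTpp`. [folklore] -/
theorem mem_tppIB_of_nearTppB {cfg : BConfig} {E : EmeryBox} {eD eA eB eC : Entry}
    (hD : E .DeltaPd = some eD) (hA : E .tpd = some eA) (hB : E .tpp = some eB)
    (hC : E .tppP = some eC) (hA0 : 0 < eA.encl.fst) {tpp : ℝ} (h : NearTppB cfg E tpp) :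
    tpp ∈ (tppIB cfg eD eA eB eC).ratCast ℝ := by
  obtain ⟨Δ, a, b, c, ⟨hΔ, ha, hb, hc⟩, htpp⟩ := h
  exact mem_inflate_of_abs_sub_le
    (tppB4_mem_tppI cfg.prec cfg.iters hA0.le (hΔ eD hD) (ha eA hA) (hb eB hB) (hc eC hC)) htpp

/-- **PER-COORDINATE SOUNDNESS** (already for v0's `imageB`): if the three-band `t_pd` entry is
positive and the clause for coordinate `i` holds at `x`, the entry technique B emits at `i`
encloses `x`. [folklore] -/
theorem mem_of_coordTokenB {cfg : BConfig} {E : EmeryBox}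
    (hA0 : ∀ eA, E .tpd = some eA → 0 < eA.encl.fst) {i : OneBandCoord} {x : ℝ}
    (hx : CoordTokenB cfg E i x) {g : Entry} (hg : imageB cfg E i = some g) : g.Mem x := by
  cases i with
  | filling =>
    dsimp only [CoordTokenB] at hx
    simp only [imageB] at hg
    cases hN : E .nHoles with
    | none => simp [hN] at hg
    | some eN =>
      simp only [hN, Option.some.injEq] at hg
      subst hg
      have hm := hx eN hN
      unfold Entry.Mem at hm ⊢
      simp only [Entry.encl, inflate_zero]
      have := mem_affine (K := ℝ) 2 (-1) hm
      have e : ((2 : ℚ) : ℝ) + ((-1 : ℚ) : ℝ) * (2 - x) = x := by push_cast; ring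
      rw [e] at this
      exact this
  | tEV =>
    dsimp only [CoordTokenB] at hx
    simp only [imageB] at hg
    cases hin : inputsB E with
    | none => simp [hin] at hg
    | some triple =>
      obtain ⟨eD, eA, eB, eC⟩ := triple
      obtain ⟨hD, hA, hB, hC⟩ := eq_of_inputsB_eq_some hin
      simp only [hin, Option.some.injEq] at hg
      subst hg
      unfold Entry.Mem Entry.encl
      exact mem_scaleB_of_nearTB hD hA hB hC (hA0 eA hA) hx
  | tpOverT =>
    dsimp only [CoordTokenB] at hx
    simp only [imageB] at hg
    cases hin : inputsB E with
    | none => simp [hin] at hg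
    | some triple =>
      obtain ⟨eD, eA, eB, eC⟩ := triple
      obtain ⟨hD, hA, hB, hC⟩ := eq_of_inputsB_eq_some hin
      simp only [hin] at hg
      split_ifs at hg with hpos
      simp only [Option.some.injEq] at hg
      subst hg
      obtain ⟨t, tp, ht, htp, rfl⟩ := hx
      unfold Entry.Mem
      simp only [Entry.encl, inflate_zero]
      exact div_mem_divPos hpos.2 (mem_tpIB_of_nearTpB hD hA hB hC (hA0 eA hA) htp)
        (mem_scaleB_of_nearTB hD hA hB hC (hA0 eA hA) ht)
  | tppOverT =>
    dsimp only [CoordTokenB] at hx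
    simp only [imageB] at hg
    cases hin : inputsB E with
    | none => simp [hin] at hg
    | some triple =>
      obtain ⟨eD, eA, eB, eC⟩ := triple
      obtain ⟨hD, hA, hB, hC⟩ := eq_of_inputsB_eq_some hin
      simp only [hin] at hg
      split_ifs at hg with hpos
      simp only [Option.some.injEq] at hg
      subst hg
      obtain ⟨t, tpp, ht, htpp, rfl⟩ := hx
      unfold Entry.Mem
      simp only [Entry.encl, inflate_zero]
      exact div_mem_divPos hpos.2 (mem_tppIB_of_nearTppB hD hA hB hC (hA0 eA hA) htpp)
        (mem_scaleB_of_nearTB hD hA hB hC (hA0 eA hA) ht)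
  | UOverT =>
    dsimp only [CoordTokenB] at hx
    simp only [imageB] at hg
    cases hin : inputsB E with
    | none => simp [hin] at hg
    | some triple =>
      obtain ⟨eD, eA, eB, eC⟩ := triple
      obtain ⟨hD, hA, hB, hC⟩ := eq_of_inputsB_eq_some hin
      cases hU : cfg.uEV with
      | none => simp [hin, hU] at hg
      | some eU =>
        simp only [hin, hU] at hg
        split_ifs at hg with hpos
        simp only [Option.some.injEq] at hg
        subst hg
        obtain ⟨t, U, ht, hUm, rfl⟩ := hx eU hU
        unfold Entry.Mem at hUm ⊢
        simp only [Entry.encl, inflate_zero]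
        exact div_mem_divPos hpos hUm (mem_scaleB_of_nearTB hD hA hB hC (hA0 eA hA) ht)
  | tperpOverT => simp [imageB] at hg
  | VOverT => simp [imageB] at hg
  | WEV => simp [imageB] at hg
  | dsd => simp [imageB] at hg
  | JmeV => simp [imageB] at hg

/-- v0's determination encloses `p` as soon as the clause holds at every coordinate it EMITS
(nothing is asked at the others). [folklore] -/
theorem imageB_mem_of_coordTokens {cfg : BConfig} {E : EmeryBox} {p : OneBandCoord → ℝ}
    (hA0 : ∀ eA, E .tpd = some eA → 0 < eA.encl.fst)
    (h : ∀ i g, imageB cfg E i = some g → CoordTokenB cfg E i (p i)) : (imageB cfg E).Mem p :=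
  fun i g hg => mem_of_coordTokenB hA0 (h i g hg) hg

/-! ## §3 The band-misfit rule `r = ρ/4` as a constructor of the clauses (reviewer N2) -/

/-- **Band misfit `ρ` at Γ, X, M, S** between the material's one-band energies
`eΓ, eX, eM, eS` and technique B's antibonding band `(0, abX, abM, abS)` at the box point
`(Δ, t_pd, t_pp, t_pp′)` (arguments shifted by `t_pp′` as in `EmeryBandReductionAcrossCu`), up to
a common constant `κ` (the extraction rows sum to zero, so `κ` drops out). [folklore] -/
def BandMisfitB (Δ a b c κ ρ eΓ eX eM eS : ℝ) : Prop :=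
  |eΓ - κ| ≤ ρ ∧ |eX - (abX (Δ + 4 * c) a + κ)| ≤ ρ ∧ |eM - (abM (Δ + 4 * c) a b + κ)| ≤ ρ ∧
    |eS - (abS (Δ + 2 * c) a b + κ)| ≤ ρ

/-- Band misfit `ρ` ⇒ the extracted `t` is within `ρ/4` of `tB4`. [folklore] -/
theorem abs_extractT_sub_tB4_le {Δ a b c κ ρ eΓ eX eM eS : ℝ}
    (h : BandMisfitB Δ a b c κ ρ eΓ eX eM eS) : |extractT eΓ eM - tB4 Δ a b c| ≤ ρ / 4 := by
  have e : tB4 Δ a b c = extractT κ (abM (Δ + 4 * c) a b + κ) := by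
    simp only [tB4, tB, extractT]; ring
  rw [e]
  exact abs_extractT_sub_le h.1 h.2.2.1

/-- Band misfit `ρ` ⇒ the extracted `t′` is within `ρ/4` of `tpB4`. [folklore] -/
theorem abs_extractTp_sub_tpB4_le {Δ a b c κ ρ eΓ eX eM eS : ℝ}
    (h : BandMisfitB Δ a b c κ ρ eΓ eX eM eS) :
    |extractTp eΓ eX eM - tpB4 Δ a b c| ≤ ρ / 4 := by
  have e : tpB4 Δ a b c = extractTp κ (abX (Δ + 4 * c) a + κ) (abM (Δ + 4 * c) a b + κ) := by
    simp only [tpB4, tpB, extractTp]; ring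
  rw [e]
  exact abs_extractTp_sub_le h.1 h.2.1 h.2.2.1

/-- Band misfit `ρ` ⇒ the extracted `t″` is within `ρ/4` of `tppB4`. [folklore] -/
theorem abs_extractTpp_sub_tppB4_le {Δ a b c κ ρ eΓ eX eM eS : ℝ}
    (h : BandMisfitB Δ a b c κ ρ eΓ eX eM eS) :
    |extractTpp eΓ eX eM eS - tppB4 Δ a b c| ≤ ρ / 4 := by
  have e : tppB4 Δ a b c = extractTpp κ (abX (Δ + 4 * c) a + κ) (abM (Δ + 4 * c) a b + κ)
      (abS (Δ + 2 * c) a b + κ) := by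
    simp only [tppB4, extractTpp, extractTp]; ring
  rw [e]
  exact abs_extractTpp_sub_le h.1 h.2.1 h.2.2.1 h.2.2.2

/-- **The rule `r = ρ/4`**: a band misfit `ρ` at a box point, with declared radii
`rT, rTp, rTpp ≥ ρ/4`, yields the three `Near*` clauses for the four-point extracted hoppings of
the material's one-band dispersion. [folklore] -/
theorem near_of_bandMisfit {cfg : BConfig} {E : EmeryBox} {Δ a b c κ ρ eΓ eX eM eS : ℝ}
    (hpt : EmeryPoint E Δ a b c) (hfit : BandMisfitB Δ a b c κ ρ eΓ eX eM eS)
    (hT : ρ / 4 ≤ (cfg.rT : ℚ)) (hTp : ρ / 4 ≤ (cfg.rTp : ℚ)) (hTpp : ρ / 4 ≤ (cfg.rTpp : ℚ)) :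
    NearTB cfg E (extractT eΓ eM) ∧ NearTpB cfg E (extractTp eΓ eX eM) ∧
      NearTppB cfg E (extractTpp eΓ eX eM eS) :=
  ⟨⟨Δ, a, b, c, hpt, (abs_extractT_sub_tB4_le hfit).trans hT⟩,
    ⟨Δ, a, b, c, hpt, (abs_extractTp_sub_tpB4_le hfit).trans hTp⟩,
    ⟨Δ, a, b, c, hpt, (abs_extractTpp_sub_tppB4_le hfit).trans hTpp⟩⟩

/-- **Hopping clauses from a band misfit**: if the material's `t_eV`, `tp/t`, `tpp/t` are the
four-point extracts of one-band energies within `ρ` of technique B's band at a box point and the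
declared radii are `≥ ρ/4`, the clauses for `t_eV`, `tp/t`, `tpp/t` hold. [folklore] -/
theorem coordTokenB_of_bandMisfit {cfg : BConfig} {E : EmeryBox} {p : OneBandCoord → ℝ}
    {Δ a b c κ ρ eΓ eX eM eS : ℝ} (hpt : EmeryPoint E Δ a b c)
    (hfit : BandMisfitB Δ a b c κ ρ eΓ eX eM eS) (hT : ρ / 4 ≤ (cfg.rT : ℚ))
    (hTp : ρ / 4 ≤ (cfg.rTp : ℚ)) (hTpp : ρ / 4 ≤ (cfg.rTpp : ℚ)) (hpT : p .tEV = extractT eΓ eM)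
    (hpTp : p .tpOverT = extractTp eΓ eX eM / extractT eΓ eM)
    (hpTpp : p .tppOverT = extractTpp eΓ eX eM eS / extractT eΓ eM) :
    CoordTokenB cfg E .tEV (p .tEV) ∧ CoordTokenB cfg E .tpOverT (p .tpOverT) ∧
      CoordTokenB cfg E .tppOverT (p .tppOverT) := by
  obtain ⟨nT, nTp, nTpp⟩ := near_of_bandMisfit hpt hfit hT hTp hTpp
  refine ⟨?_, ?_, ?_⟩
  · show NearTB cfg E (p .tEV)
    rw [hpT]; exact nT
  · exact ⟨_, _, nT, nTp, hpTp⟩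
  · exact ⟨_, _, nT, nTpp, hpTpp⟩

end Summit.Ventures.CertifiedManyBodySolver.Downfold
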